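import Summits.RiemannHypothesis.RiemannHypothesis.Theorems.Splittings.EarlyAppointmentsXiLevel0Inputs

/-!
# EarlyAppointments — window counts and Ξ-budgets under radius GROWTH `R γ ≤ √γ/20` (slot 12; W-07 C6, `ZetaWindowBudget` rev 6 §Growth)
RH-FREE.  Nothing here bears on the truth of RH; RH is not proved.

Verbatim re-homing of `ZetaWindowBudget-W07c8-C6-rh-idea-4-g17.lean` rev 6 (aef335293cc34000) l.738–930 (§Growth: the general
window bound `window_count_abs_le_gen`, `growth_side`, and the budget assembly `xiBudgets_of_sqrt` / `xiBudgets_hold_sqrt` /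
`xiLevel0Inputs4_of_class_sqrt` for radius profiles `R γ ≤ √γ/20`, `T₁ ≥ 6.1220092·10¹⁰`), on top of slots (11a)/(11b)/(11c);
plus the five closed-witness one-liners of C6's cut (ideators l.4333) that (CA160) R1 kept out of (11b)/(11c).
Credit rh-idea-4 g17 (W-07 cycle 8, cell C6); critic rh-split-ref-2 g16 REPLAY (12) PASS(kernel)+PASS(object) 46/46 (ideators l.4346).
-/

set_option linter.dupNamespace false  -- D-0017: the mandated namespace `Summit.<S>.<S>.…` repeats `RiemannHypothesis`
namespace Summit.RiemannHypothesis.RiemannHypothesis.Theorems.Splittings.EarlyAppointmentsXiWindowCountsGrowth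

open Real Literature.NumberTheory.LFunctions
open Summit.RiemannHypothesis.RiemannHypothesis.Theorems.Splittings.EarlyAppointmentsXiWindowCounts
open Summit.RiemannHypothesis.RiemannHypothesis.Theorems.Splittings.EarlyAppointmentsXiZetaDictionary
open Summit.RiemannHypothesis.RiemannHypothesis.Theorems.Splittings.EarlyAppointmentsXiLevel0Inputs

/-! ## rev 6 (C1 l.4280): the booked RADIUS PROFILE grows (`Rprof ≤ √γ/20`), so drop `R ≤ 135` for `R γ ≤ √γ/20` -/

section Growth

open Summit.RiemannHypothesis.RiemannHypothesis.Theses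

/-- **ANY WINDOW `(a, b]` within `D` of the centre `γ`**, general form: `|N(b) − N(a) − (b−a)/s(γ)| ≤ 2·W₁(2γ) + 1/100` whenever
`3.0610046·10¹⁰ ≤ a ≤ b`, `γ − D ≤ a`, `b ≤ γ + D`, `4D ≤ γ` and `100·(b − a)·D ≤ γ` (curvature of `log` across the window). -/
theorem window_count_abs_le_gen {γ a b D : ℝ} (ha : 30610046000 ≤ a) (hab : a ≤ b) (hγa : γ - D ≤ a)
    (hbγ : b ≤ γ + D) (hD4 : 4 * D ≤ γ) (hsmall : 100 * ((b - a) * D) ≤ γ) :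
    |(zetaZeroCount b : ℝ) - zetaZeroCount a - (b - a) / xiSpacing γ| ≤ 2 * W₁ (2 * γ) + 1 / 100 := by
  have hπ := Real.pi_gt_three
  have hπ0 := Real.pi_pos
  have hD0 : 0 ≤ D := by linarith
  have ha0 : 0 < a := by linarith
  have hγ0 : 0 < γ := by linarith
  have hb0 : 0 < b := by linarith
  have hH : 0 ≤ b - a := by linarith
  have ha34 : 3 * γ ≤ 4 * a := by linarith
  have hup := ZetaZeroWindows.count_diff_le (T := a) (H := b - a) (by linarith) hH
  have hlo := ZetaZeroWindows.count_diff_ge (T := a) (H := b - a) (by linarith) hH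
  rw [show a + (b - a) = b by ring] at hup hlo
  have s1 := abs_zetaArgS_le_hsw (T := a) ha
  have s2 := abs_zetaArgS_le_hsw (T := b) (by linarith)
  have w1 : W₁ a ≤ W₁ (2 * γ) := W₁_mono (by linarith) (by linarith)
  have w2 : W₁ b ≤ W₁ (2 * γ) := W₁_mono (by linarith) (by linarith)
  have eb : Real.log (b / (2 * π)) = Real.log (γ / (2 * π)) + Real.log (b / γ) := by
    rw [← Real.log_mul (by positivity) (by positivity)]; congr 1; field_simp
  have ea : Real.log (a / (2 * π)) = Real.log (γ / (2 * π)) + Real.log (a / γ) := by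
    rw [← Real.log_mul (by positivity) (by positivity)]; congr 1; field_simp
  have lb : Real.log (b / γ) ≤ D / γ := by
    have h := Real.log_le_sub_one_of_pos (show 0 < b / γ by positivity)
    have e : b / γ - 1 = (b - γ) / γ := by field_simp
    rw [e] at h
    exact h.trans (div_le_div_of_nonneg_right (by linarith) hγ0.le)
  have la : -(D / a) ≤ Real.log (a / γ) := by
    have h := Real.one_sub_inv_le_log_of_pos (show 0 < a / γ by positivity)
    have e : 1 - (a / γ)⁻¹ = -((γ - a) / a) := by field_simp; ring
    rw [e] at h
    have : (γ - a) / a ≤ D / a := div_le_div_of_nonneg_right (by linarith) ha0.le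
    linarith
  have hsp := div_xiSpacing γ (b - a)
  have c1 : (b - a) / (2 * π) * (D / γ) ≤ 1 / 400 := by
    rw [show (b - a) / (2 * π) * (D / γ) = (b - a) * D / (2 * π * γ) by field_simp]
    rw [div_le_iff₀ (by positivity)]; nlinarith
  have c2 : (b - a) / (2 * π) * (D / a) ≤ 1 / 400 := by
    rw [show (b - a) / (2 * π) * (D / a) = (b - a) * D / (2 * π * a) by field_simp]
    rw [div_le_iff₀ (by positivity)]; nlinarith
  have c3 : 2.4 / (π * a) ≤ 1 / 400 := by
    rw [div_le_iff₀ (by positivity)]; nlinarith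
  have m1 : (b - a) / (2 * π) * Real.log (b / (2 * π)) ≤ (b - a) / xiSpacing γ + 1 / 400 := by
    rw [hsp, eb, mul_add]
    have := mul_le_mul_of_nonneg_left lb (show 0 ≤ (b - a) / (2 * π) by positivity)
    linarith
  have m2 : (b - a) / xiSpacing γ - 1 / 400 ≤ (b - a) / (2 * π) * Real.log (a / (2 * π)) := by
    rw [hsp, ea, mul_add]
    have := mul_le_mul_of_nonneg_left la (show 0 ≤ (b - a) / (2 * π) by positivity)
    linarith
  unfold W₁ at *
  rw [abs_le]; constructor <;> linarith

/-- The growth side conditions at a column of radius `r ≤ √γ/20`, `γ ≥ 2 · 3.0610046·10¹⁰`: `4(r+1) ≤ γ`, the window's left end stays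
above the HSW threshold (`γ − r − 1 ≥ 3.0610046·10¹⁰`), and every window of width `≤ 2r + 2` has `100·(b−a)·(r+1) ≤ γ`. -/
theorem growth_side {γ r : ℝ} (hγ : 61220092000 ≤ γ) (hr : 0 ≤ r) (hrq : r ≤ Real.sqrt γ / 20) :
    4 * (r + 1) ≤ γ ∧ 30610046000 ≤ γ - r - 1 ∧
      ∀ a b : ℝ, a ≤ b → b - a ≤ 2 * r + 2 → 100 * ((b - a) * (r + 1)) ≤ γ := by
  set q := Real.sqrt γ with hq
  have hq0 : 0 ≤ q := Real.sqrt_nonneg γ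
  have hqq : q * q = γ := Real.mul_self_sqrt (by linarith)
  have hq1 : 174000 ≤ q := by
    rw [hq]; apply Real.le_sqrt_of_sq_le; nlinarith
  have hkey : 200 * (r + 1) ^ 2 ≤ γ := by
    have h1 : (r + 1) ^ 2 ≤ (q / 20 + 1) ^ 2 := by
      apply pow_le_pow_left₀ (by linarith); linarith
    nlinarith
  have hhalf : r + 1 ≤ γ / 2 := by
    have : q / 20 + 1 ≤ q * q / 2 := by nlinarith
    linarith
  refine ⟨by nlinarith, by linarith, fun a b hab hw => ?_⟩
  calc 100 * ((b - a) * (r + 1)) ≤ 100 * ((2 * r + 2) * (r + 1)) := by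
        apply mul_le_mul_of_nonneg_left _ (by norm_num)
        exact mul_le_mul_of_nonneg_right hw (by linarith)
    _ = 200 * (r + 1) ^ 2 := by ring
    _ ≤ γ := hkey

/-- The three dictionary shapes ⇒ both budgets, growth form (`R γ ≤ √γ/20`). -/
theorem xiBudgets_of_sqrt {B : ℝ → ℕ} {R : ℝ → ℝ} {T₁ : ℝ}
    (hDc : XiDictColumn) (hDr : XiDictRight) (hDl : XiDictLeft)
    (hT₁ : 61220092000 ≤ T₁) (hR : ∀ γ, T₁ < γ → R γ ≤ Real.sqrt γ / 20) (hs : ∀ γ, T₁ < γ → 0 < xiSpacing γ)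
    (hB : ∀ γ, T₁ < γ → 2 * W₁ (2 * γ) + 1 / 100 ≤ (B γ : ℝ)) :
    XiColumnBudget B R T₁ ∧ XiHalfSlabBudget B R T₁ := by
  refine ⟨?_, ?_⟩
  · -- COLUMN
    intro γ hγ r hsr hrR
    have hr0 : 0 < r := lt_of_lt_of_le (hs γ hγ) hsr
    have hrq : r ≤ Real.sqrt γ / 20 := hrR.trans (hR γ hγ)
    obtain ⟨hD4, hlow, hwin⟩ := growth_side (by linarith) hr0.le hrq
    have hsγ := hs γ hγ
    have hBγ := hB γ hγ
    -- for every ε ∈ (0,1]: Σ − 2r/s ≤ 2W₁(2γ) + 1/100 + 2ε/s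
    have key : ∀ ε : ℝ, 0 < ε → ε ≤ 1 →
        (∑ᶠ u ∈ {u : ℂ | riemannXiUpper u = 0 ∧ |u.re - γ| ≤ r}, xiOrd u) - 2 * r / xiSpacing γ ≤
          2 * W₁ (2 * γ) + 1 / 100 + 2 * ε / xiSpacing γ := by
      intro ε hε hε1
      have d := hDc γ r ε hr0.le hε (by linarith)
      have w := window_count_abs_le_gen (γ := γ) (a := γ - r - ε) (b := γ + r + ε) (D := r + 1) (by linarith) (by linarith)
          (by linarith) (by linarith) hD4 (hwin _ _ (by linarith) (by linarith))
      have w' := (abs_le.1 w).2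
      have e : (γ + r + ε - (γ - r - ε)) / xiSpacing γ = 2 * r / xiSpacing γ + 2 * ε / xiSpacing γ := by
        rw [show γ + r + ε - (γ - r - ε) = 2 * r + 2 * ε by ring, add_div]
      linarith
    have main : (∑ᶠ u ∈ {u : ℂ | riemannXiUpper u = 0 ∧ |u.re - γ| ≤ r}, xiOrd u) - 2 * r / xiSpacing γ ≤
        2 * W₁ (2 * γ) + 1 / 100 := by
      refine le_of_forall_pos_le_add fun δ hδ => ?_
      set ε := min 1 (δ * xiSpacing γ / 2) with hεdef
      have hε : 0 < ε := lt_min one_pos (by nlinarith [mul_pos hδ hsγ])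
      have hε1 : ε ≤ 1 := min_le_left _ _
      have hε2 : ε ≤ δ * xiSpacing γ / 2 := min_le_right _ _
      have h2 : 2 * ε / xiSpacing γ ≤ δ := by
        rw [div_le_iff₀ hsγ]; linarith
      linarith [key ε hε hε1]
    show (∑ᶠ u ∈ {u : ℂ | riemannXiUpper u = 0 ∧ |u.re - γ| ≤ r},
        ((analyticOrderAt riemannXiUpper u).toNat : ℝ)) - 2 * r / xiSpacing γ ≤ (B γ : ℝ)
    exact main.trans hBγ
  · -- HALF-SLABS
    intro γ hγ r hsr hrR
    have hr0 : 0 < r := lt_of_lt_of_le (hs γ hγ) hsr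
    have hrq : r ≤ Real.sqrt γ / 20 := hrR.trans (hR γ hγ)
    obtain ⟨hD4, hlow, hwin⟩ := growth_side (by linarith) hr0.le hrq
    have hsγ := hs γ hγ
    have hBγ := hB γ hγ
    constructor
    · -- right (γ, γ+r]: exact dictionary
      have d := hDr γ r (by linarith) hr0.le
      have w := window_count_abs_le_gen (γ := γ) (a := γ) (b := γ + r) (D := r + 1) (by linarith) (by linarith)
          (by linarith) (by linarith) hD4 (hwin _ _ (by linarith) (by linarith))
      rw [show γ + r - γ = r by ring] at w
      show |(∑ᶠ u ∈ {u : ℂ | riemannXiUpper u = 0 ∧ γ < u.re ∧ u.re ≤ γ + r},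
          ((analyticOrderAt riemannXiUpper u).toNat : ℝ)) - r / xiSpacing γ| ≤ 1 + (B γ : ℝ)
      have e : (∑ᶠ u ∈ {u : ℂ | riemannXiUpper u = 0 ∧ γ < u.re ∧ u.re ≤ γ + r},
          ((analyticOrderAt riemannXiUpper u).toNat : ℝ)) = (zetaZeroCount (γ + r) : ℝ) - zetaZeroCount γ := d
      rw [e]
      linarith
    · -- left [γ−r, γ): sandwich with ε → 0
      have key : ∀ ε : ℝ, 0 < ε → ε ≤ 1 → ε ≤ r →
          |(∑ᶠ u ∈ {u : ℂ | riemannXiUpper u = 0 ∧ γ - r ≤ u.re ∧ u.re < γ}, xiOrd u) - r / xiSpacing γ| ≤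
            2 * W₁ (2 * γ) + 1 / 100 + ε / xiSpacing γ := by
        intro ε hε hε1 hεr
        obtain ⟨dlo, dhi⟩ := hDl γ r ε hε hεr (by linarith)
        have wu := window_count_abs_le_gen (γ := γ) (a := γ - r - ε) (b := γ) (D := r + 1) (by linarith) (by linarith)
          (by linarith) (by linarith) hD4 (hwin _ _ (by linarith) (by linarith))
        have wl := window_count_abs_le_gen (γ := γ) (a := γ - r) (b := γ - ε) (D := r + 1) (by linarith) (by linarith)
          (by linarith) (by linarith) hD4 (hwin _ _ (by linarith) (by linarith))
        rw [show γ - (γ - r - ε) = r + ε by ring, add_div] at wu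
        rw [show γ - ε - (γ - r) = r - ε by ring, sub_div] at wl
        have wu' := (abs_le.1 wu).2
        have wl' := (abs_le.1 wl).1
        rw [abs_le]; constructor <;> linarith
      have main : |(∑ᶠ u ∈ {u : ℂ | riemannXiUpper u = 0 ∧ γ - r ≤ u.re ∧ u.re < γ}, xiOrd u) - r / xiSpacing γ| ≤
          2 * W₁ (2 * γ) + 1 / 100 := by
        refine le_of_forall_pos_le_add fun δ hδ => ?_
        set ε := min (min 1 r) (δ * xiSpacing γ) with hεdef
        have hε : 0 < ε := lt_min (lt_min one_pos hr0) (mul_pos hδ hsγ)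
        have hε1 : ε ≤ 1 := (min_le_left _ _).trans (min_le_left _ _)
        have hεr : ε ≤ r := (min_le_left _ _).trans (min_le_right _ _)
        have hε2 : ε ≤ δ * xiSpacing γ := min_le_right _ _
        have h2 : ε / xiSpacing γ ≤ δ := by rw [div_le_iff₀ hsγ]; linarith
        linarith [key ε hε hε1 hεr]
      show |(∑ᶠ u ∈ {u : ℂ | riemannXiUpper u = 0 ∧ γ - r ≤ u.re ∧ u.re < γ},
          ((analyticOrderAt riemannXiUpper u).toNat : ℝ)) - r / xiSpacing γ| ≤ 1 + (B γ : ℝ)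
      have e : |(∑ᶠ u ∈ {u : ℂ | riemannXiUpper u = 0 ∧ γ - r ≤ u.re ∧ u.re < γ}, xiOrd u) - r / xiSpacing γ| =
          |(∑ᶠ u ∈ {u : ℂ | riemannXiUpper u = 0 ∧ γ - r ≤ u.re ∧ u.re < γ},
            ((analyticOrderAt riemannXiUpper u).toNat : ℝ)) - r / xiSpacing γ| := rfl
      linarith [main, e]

/-- ★ **BUDGETS AT A GROWING RADIUS PROFILE** (`R γ ≤ √γ/20`, e.g. C1's `Rprof Btb γ = max 54 (Kprof Btb γ / 2)` via
`rprof_TB_le_sqrt`): both budget conjuncts, UNCONDITIONALLY. -/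
theorem xiBudgets_hold_sqrt {B : ℝ → ℕ} {R : ℝ → ℝ} {T₁ : ℝ}
    (hT₁ : 61220092000 ≤ T₁) (hR : ∀ γ, T₁ < γ → R γ ≤ Real.sqrt γ / 20) (hs : ∀ γ, T₁ < γ → 0 < xiSpacing γ)
    (hB : ∀ γ, T₁ < γ → 2 * W₁ (2 * γ) + 1 / 100 ≤ (B γ : ℝ)) :
    XiColumnBudget B R T₁ ∧ XiHalfSlabBudget B R T₁ := by
  obtain ⟨hDc, hDr, hDl⟩ := xiDict_of_halfOpen xiDictHalfOpen_holds xiZerosWindowFinite_holds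
  exact xiBudgets_of_sqrt hDc hDr hDl hT₁ hR hs hB

/-- ★ `XiLevel0Inputs4 B R T₁` ⟸ `XiInLogCombClass` at ANY booked profile with `R γ ≤ √γ/20` (the route's `Rprof` included). -/
theorem xiLevel0Inputs4_of_class_sqrt {B : ℝ → ℕ} {R : ℝ → ℝ} {T₁ : ℝ}
    (hcls : EarlyAppointments.XiInLogCombClass)
    (hT₁ : 61220092000 ≤ T₁) (hR : ∀ γ, T₁ < γ → R γ ≤ Real.sqrt γ / 20) (hs : ∀ γ, T₁ < γ → 0 < xiSpacing γ)
    (hB : ∀ γ, T₁ < γ → 2 * W₁ (2 * γ) + 1 / 100 ≤ (B γ : ℝ)) :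
    XiLevel0Inputs4 B R T₁ :=
  ⟨hcls, xiBudgets_hold_sqrt hT₁ hR hs hB⟩

end Growth

/-! ### Closed witnesses (C6's cut one-liners, `w7c8/cut/` l.4333: (11b) l.292–297, (11c) l.200–204) -/

/-- The three ε-fattened window shapes hold (closed witnesses; one line each from `xiDictHalfOpen_holds`). -/
theorem xiDictColumn_holds : XiDictColumn := (xiDict_of_halfOpen xiDictHalfOpen_holds xiZerosWindowFinite_holds).1

/-- The right half-slab dictionary shape holds (closed witness). -/
theorem xiDictRight_holds : XiDictRight := (xiDict_of_halfOpen xiDictHalfOpen_holds xiZerosWindowFinite_holds).2.1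

/-- The left half-slab dictionary shape holds (closed witness). -/
theorem xiDictLeft_holds : XiDictLeft := (xiDict_of_halfOpen xiDictHalfOpen_holds xiZerosWindowFinite_holds).2.2

/-- The booked column budget alone (closed witness). -/
theorem xiColumnBudget_booked : XiColumnBudget Bstar Rstar Tstar := xiBudgets_booked.1

/-- The booked half-slab budget alone (closed witness). -/
theorem xiHalfSlabBudget_booked : XiHalfSlabBudget Bstar Rstar Tstar := xiBudgets_booked.2

end Summit.RiemannHypothesis.RiemannHypothesis.Theorems.Splittings.EarlyAppointmentsXiWindowCountsGrowth
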